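import Literature.NumberTheory.Automorphic.AutomorphicRepsGL
import Literature.NumberTheory.Automorphic.IrreducibleClasses
import HarnessLib

/-!
# Local components `π_v` of a Borel–Jacquet automorphic representation of `GL_n(𝔸_K)`

Trunk: Automorphic (support for the summit statement `Langlands`, lang.S02: local–global
compatibility at every finite place needs the local component `π_v`).

Let `K` be a number field and `π = W / W'` an automorphic representation of `GL_n(𝔸_K)` in the
sense of the accepted Borel–Jacquet datum `AutomorphicRepData (AutomorphyDatum.gl n K hcpt)`
(`W' < W` stable subspaces of automorphic forms on `GL_n(𝔸_K)`, `W / W'` irreducible; Borel–Jacquet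
1979, 4.6). As a `(𝔤, K_∞) × GL_n(𝔸_K^∞)`-module `W / W' ≅ π_∞ ⊗ ⊗'_v π_v` with `π_v` an
irreducible admissible representation of `GL_n(K_v)` (Flath 1979, Thm. 3–4), and the restriction
of `W / W'` to `GL_n(K_v)` (embedded by the accepted `GLn.ofLocal n K v : GL_n(K_v) →* GL_n(𝔸_K)`)
is `π_v`-isotypic. The accepted tree extracts local components only for the `L²` model
(`HasLocalComponentAt` of `GLnAdelicStructure`, for closed subrepresentations of `L²_cusp`); the
accepted `AutomorphicRepsGL` docstring records that none is extracted for the Borel–Jacquet datum.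
This file supplies the missing predicate, in the same shape as the accepted `L²` one:

* `AutomorphicRepData.HasLocalComponentAt π v ρ` — for a representation `ρ` of `GL_n(K_v)` on
  `V`: there is a `ℂ`-linear map `f : V → (GL_n(𝔸_K) → ℂ)` with values in `W` but not in `W'`
  (so `f` is non-zero into `W / W'`) intertwining `ρ` with right translation by `GL_n(K_v)`
  **modulo `W'`**: `f (ρ g x) - R(ι_v g) (f x) ∈ W'`. Meaningful for `ρ` irreducible (smooth,
  admissible): then `ρ ≅ π_v` (a non-zero `GL_n(K_v)`-map from an irreducible `ρ` into the
  `π_v`-isotypic module `W / W'` is an embedding of `ρ ≅ π_v`); for reducible `ρ` a non-zero map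
  may exist for trivial reasons, exactly as for the accepted `L²` predicate.
* Named facts (D-0014, `def … : Prop`): `exists_hasLocalComponentAt` (Flath: every `π` has an
  irreducible smooth local component at every `v`, as an accepted `SmoothIrrep`) and
  `hasLocalComponentAt_unique` (it is unique up to isomorphism). These are the non-vacuity /
  no-junk guards of the `∃ π_v` in the summit statement.

Design: the intertwining identity is imposed modulo `W'` on functions `GL_n(𝔸_K) → ℂ` (the ambient
type of `W`, `W'`), so no proof that `GLn.ofLocal g` lies in the finite-adelic subgroup
`(AutomorphyDatum.gl n K hcpt).finiteAdelic` is needed to *state* it (it does: its archimedean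
component is `1`, accepted `GLn.fst_coe_ofLocal_apply`). No `sorry`. Mathlib has no automorphic
representations (accepted `AutomorphicRepsGL`, Mathlib note).

## References

* D. Flath, *Decomposition of representations into tensor products*, Corvallis 1979, part 1,
  Thm. 3, Thm. 4. [FlathCorvallis1979]
* A. Borel, H. Jacquet, *Automorphic forms and automorphic representations*, Corvallis 1979,
  part 1, §4.6. [BorelJacquetCorvallis1979]
-/

-- Mathlib idiom (Mathlib/Algebra/Lie/OfAssociative.lean); the automorphy datum mentions Lie subalgebras of matrix algebras
attribute [local instance 100] LieRing.ofAssociativeRing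

open scoped MatrixGroups Matrix Classical
open NumberField NumberField.mixedEmbedding IsDedekindDomain

noncomputable section

namespace Literature.NumberTheory.Automorphic

namespace AutomorphicRepData

variable {n : ℕ} {K : Type} [Field K] [NumberField K] {hcpt : isCompact_glFiniteIntegralLevel n K}

/-- `π = W / W'` **has local component `ρ` at the finite place `v`** (`ρ` a representation of
`GL_n(K_v)` on `V`, `K_v = v.adicCompletion K`): there is a `ℂ`-linear
`f : V → (GL_n(𝔸_K) → ℂ)` with `range f ≤ W`, `range f ≰ W'`, and
`f (ρ g x) - R(GLn.ofLocal g)(f x) ∈ W'` for all `g ∈ GL_n(K_v)`, `x ∈ V` (`R` = accepted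
`rightTranslation`), i.e. `f` induces a non-zero `GL_n(K_v)`-equivariant map `V → W / W'`.
For irreducible `ρ` this says `ρ ≅ π_v`, the local factor of `W / W' ≅ π_∞ ⊗ ⊗' π_v`.
[cite: FlathCorvallis1979, Thm. 3 and Thm. 4] [cite: BorelJacquetCorvallis1979, §4.6] -/
def HasLocalComponentAt (π : AutomorphicRepData (AutomorphyDatum.gl n K hcpt))
    (v : HeightOneSpectrum (𝓞 K)) {V : Type*} [AddCommGroup V] [Module ℂ V]
    (ρ : Representation ℂ (GL (Fin n) (v.adicCompletion K)) V) : Prop :=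
  ∃ f : V →ₗ[ℂ] ((AdelicGroupData.gl n K).Adelic → ℂ),
    LinearMap.range f ≤ π.W ∧ ¬ LinearMap.range f ≤ π.W' ∧
      ∀ (g : GL (Fin n) (v.adicCompletion K)) (x : V),
        f (ρ g x) - rightTranslation (AdelicGroupData.gl n K) (GLn.ofLocal n K v g) (f x) ∈ π.W'

/-- A local component map is non-zero: some `f x ∉ W'` (definitional unfolding of
`¬ range f ≤ W'`). [folklore] -/
theorem HasLocalComponentAt.exists_not_mem {π : AutomorphicRepData (AutomorphyDatum.gl n K hcpt)}
    {v : HeightOneSpectrum (𝓞 K)} {V : Type*} [AddCommGroup V] [Module ℂ V]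
    {ρ : Representation ℂ (GL (Fin n) (v.adicCompletion K)) V} (h : π.HasLocalComponentAt v ρ) :
    ∃ (f : V →ₗ[ℂ] ((AdelicGroupData.gl n K).Adelic → ℂ)) (x : V), f x ∈ π.W ∧ f x ∉ π.W' := by
  obtain ⟨f, hW, hW', -⟩ := h
  obtain ⟨y, hy, hy'⟩ := Set.not_subset.mp hW'
  obtain ⟨x, rfl⟩ := LinearMap.mem_range.mp hy
  exact ⟨f, x, hW (LinearMap.mem_range_self f x), hy'⟩

variable (n K hcpt) in
/-- **Existence of local components (Flath), Borel–Jacquet model.** Every automorphic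
representation `π = W / W'` of `GL_n(𝔸_K)` has at every finite place `v` an irreducible smooth
local component `π_v` (an accepted `SmoothIrrep (GL (Fin n) K_v)`; it is moreover admissible).
Named fact (D-0014). [cite: FlathCorvallis1979, Thm. 3 and Thm. 4] -/
def exists_hasLocalComponentAt : Prop :=
  ∀ (π : AutomorphicRepData (AutomorphyDatum.gl n K hcpt)) (v : HeightOneSpectrum (𝓞 K)),
    ∃ πv : SmoothIrrep (GL (Fin n) (v.adicCompletion K)), π.HasLocalComponentAt v πv.ρ

variable (n K hcpt) in
/-- **Uniqueness of local components, Borel–Jacquet model.** Two irreducible smooth local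
components of `π` at `v` are isomorphic (`W / W'` restricted to `GL_n(K_v)` is `π_v`-isotypic).
Named fact (D-0014). [cite: FlathCorvallis1979, Thm. 3 and Thm. 4] -/
def hasLocalComponentAt_unique : Prop :=
  ∀ (π : AutomorphicRepData (AutomorphyDatum.gl n K hcpt)) (v : HeightOneSpectrum (𝓞 K))
    (πv πv' : SmoothIrrep (GL (Fin n) (v.adicCompletion K))),
    π.HasLocalComponentAt v πv.ρ → π.HasLocalComponentAt v πv'.ρ → IrrClass.mk πv = IrrClass.mk πv'

variable (n K hcpt) in
/-- **Local components and Satake parameters agree.** If `π` has Satake parameter `α` at `v`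
(accepted adelic `HasSatakeParamAt`, Hecke eigenvalues `q_v^{i(n-i)/2} e_i(α)` on a spherical
vector) and irreducible smooth local component `π_v`, then `π_v` has a non-zero vector fixed by
`GL_n(𝒪_v)` (it is the unramified principal series with Satake parameter `α`). Only the
spherical consequence is recorded, the accepted tree having no unramified principal series of
`GL_n(K_v)`. Named fact (D-0014). [cite: FlathCorvallis1979, Thm. 3] [cite: BorelJacquetCorvallis1979, §4.6] -/
def hasLocalComponentAt_spherical_of_hasSatakeParamAt : Prop :=
  ∀ (π : AutomorphicRepData (AutomorphyDatum.gl n K hcpt)) (v : HeightOneSpectrum (𝓞 K))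
    (α : Multiset ℂ) (πv : SmoothIrrep (GL (Fin n) (v.adicCompletion K))),
    π.HasSatakeParamAt v α → π.HasLocalComponentAt v πv.ρ →
      ∃ x : πv.V, x ≠ 0 ∧ ∀ g ∈ (Matrix.GeneralLinearGroup.map
        ((v.adicCompletionIntegers K).subtype :
          v.adicCompletionIntegers K →+* v.adicCompletion K)).range,
        πv.ρ g x = x

end AutomorphicRepData

end Literature.NumberTheory.Automorphic

end
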